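import Summits.CriticalPhenomena.CardyFormulaZ2.Theorems.ParafermionFamiliesToSLESix.Negative.CruxModuloBulkNondegenerate
import Summits.CriticalPhenomena.CardyFormulaZ2.Theses.CardyComplexCone
import Literature.Probability.LatticeModels.MedialWindingBridge

/-!
# `ParafermionFamiliesToSLESix` (stmt-CriticalPhenomena-10814) and its edge-guarded twin are the
# bare conjecture in the vanishing world — non-degeneracy is absent from the hypotheses

Refuter `refuter-cdisprove-stmt-CriticalPhenomena-10814-g2-0` (cdisprove, cycle 2). Negative-side
support for the provers and the repair planner of the crux
`ParafermionFamiliesToSLESix := WeakHolomorphy → ParafermionPrecompact → (SLE₆ along every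
admissible family)` and of its announced repair shape, the edge-guarded twin
`CardyComplexCone.ParafermionToSLESixFamilies` (stmt-CriticalPhenomena-11389). No `def` is
introduced; "vanishing" is spelled with the sibling vocabulary `IsFamily`, `VanishesOn`
(`δ^{-1/3} F_δ → 0` uniformly on a compact, eventually in the mesh).

* `not_vanishing_of_not_weakHolomorphy` — if `δ^{-1/3}F_δ → 0` on compacts along every admissible
  family, the rank-2 crux `WeakHolomorphy` holds (the `δ^{5/3}`-weighted sums of `o(δ^{1/3})` over
  `O(δ^{-2})` medial vertices are `o(1)`: sibling `weakSum_tendsto_zero_of_vanishesOn`; stated in the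
  negative shape); with cycle 1
  (`ParafermionPrecompact ↔` vanishing) BOTH by-name hypotheses of the crux hold there, so
  `parafermionFamiliesToSLESix_iff_conjecture_of_vanishing`: the crux IS
  `SLE6LimitZ2AllDiscretisations` in that world.
* `parafermionToSLESixFamilies_iff_conjecture_of_looseVanishing` — the same for the twin: if
  `δ^{-1/3}F_δ → 0` on compacts along every LOOSE family (carrier, mesh, eventual admissibility —
  the twin's family class), both hypotheses of the twin hold (weak holomorphy as above; the
  edge-guarded bound with `C = 1` and the edge-guarded equicontinuity by the triangle inequality),
  so the twin, too, is then the bare conjecture; `parafermionFamiliesToSLESix_iff_twin_of_looseVanishing`.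
  The edge guards cure the COLLAPSE of stmt-11293 (the guarded clauses no longer force vanishing)
  but do not EXCLUDE vanishing: no hypothesis of either implication is a non-degeneracy statement.
  Consequence: any proof must derive the `δ^{1/3}` lower bound (an open estimate) inside the
  argument or carry it as an explicit hypothesis; the negative packagings
  `…_false_of_…_of_not_conjecture` record that in the vanishing world only a failure of conformal
  invariance of bond percolation on `ℤ²` could refute either item.
-/

noncomputable section

namespace Summit.CriticalPhenomena.CardyFormulaZ2.Theorems.ParafermionFamiliesToSLESix.Negative

open scoped Topology
open Filter MeasureTheory Set
open Literature.Probability.LatticeModels Literature.Probability.Percolation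
open Literature.Probability.RandomPlanarGeometry
open Summit.CriticalPhenomena.CardyFormulaZ2.Theses.CardySusyWard
open Summit.CriticalPhenomena.CardyFormulaZ2.Theorems.ParafermionPrecompact.Negative
  (F IsFamily VanishesOn ClauseBoundEdges ClauseEquicontEdges weakSum_tendsto_zero_of_vanishesOn
   parafermionPrecompact_iff_vanishing)

/-! ## The typed crux -/

/-- **Vanishing ⇒ `WeakHolomorphy`**, in the negative shape `¬WeakHolomorphy → ¬vanishing`: if
`δ^{-1/3} F_δ → 0` uniformly on compacts along every admissible family, the weak-holomorphy sums
`δ^{5/3} Σ_z F_δ(z) ∂̄φ(z_δ)` tend to `0` (sibling `weakSum_tendsto_zero_of_vanishesOn`), so the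
rank-2 crux of the route holds for free in the vanishing world; equivalently a certified failure of
`WeakHolomorphy` would refute vanishing. [folklore] -/
theorem not_vanishing_of_not_weakHolomorphy (hW : ¬ WeakHolomorphy) :
    ¬ ∀ (D : DobrushinDomain) (Λ : ℝ → DiscreteDobrushin), IsFamily D Λ →
      ∀ K : Set ℂ, IsCompact K → K ⊆ D.carrier → VanishesOn Λ K :=
  fun hV => hW fun D Λ h1 h2 h3 h4 h5 h6 _ hφ hsupp hsub =>
    weakSum_tendsto_zero_of_vanishesOn hφ hsupp (hV D Λ ⟨h1, h2, h3, h4, h5, h6⟩ _ hsupp.isCompact hsub)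

/-- **In the vanishing world the typed crux IS Smirnov's conjecture**: both by-name hypotheses
(`WeakHolomorphy`, and `ParafermionPrecompact` which as typed is EQUIVALENT to vanishing) hold
there. [folklore] -/
theorem parafermionFamiliesToSLESix_iff_conjecture_of_vanishing
    (hV : ∀ (D : DobrushinDomain) (Λ : ℝ → DiscreteDobrushin), IsFamily D Λ →
      ∀ K : Set ℂ, IsCompact K → K ⊆ D.carrier → VanishesOn Λ K) :
    ParafermionFamiliesToSLESix ↔
      Summit.CriticalPhenomena.CardyFormulaZ2.SLE6LimitZ2AllDiscretisations := by
  rw [parafermionFamiliesToSLESix_iff_conjecture]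
  refine ⟨fun h => h (Classical.byContradiction fun hW => not_vanishing_of_not_weakHolomorphy hW hV)
    (parafermionPrecompact_iff_vanishing.2 hV), fun h _ _ => h⟩

/-- Negative packaging: in the vanishing world a failure of the conjecture (and nothing else)
refutes the typed crux. [folklore] -/
theorem parafermionFamiliesToSLESix_false_of_vanishing_of_not_conjecture
    (hV : ∀ (D : DobrushinDomain) (Λ : ℝ → DiscreteDobrushin), IsFamily D Λ →
      ∀ K : Set ℂ, IsCompact K → K ⊆ D.carrier → VanishesOn Λ K)
    (hC : ¬ Summit.CriticalPhenomena.CardyFormulaZ2.SLE6LimitZ2AllDiscretisations) :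
    ¬ ParafermionFamiliesToSLESix :=
  fun h => hC ((parafermionFamiliesToSLESix_iff_conjecture_of_vanishing hV).1 h)

/-! ## The edge-guarded twin `CardyComplexCone.ParafermionToSLESixFamilies` (stmt-11389) -/

/-- Vanishing on `K` gives the EDGE-GUARDED precompactness clauses on `K` (bound with `C = 1`,
equicontinuity by the triangle inequality): the guards do not exclude vanishing. [folklore] -/
theorem clausesEdges_of_vanishesOn {Λ : ℝ → DiscreteDobrushin} {K : Set ℂ} (h : VanishesOn Λ K) :
    ClauseBoundEdges Λ K ∧ ClauseEquicontEdges Λ K := by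
  refine ⟨⟨1, ?_⟩, fun ε hε => ⟨1, one_pos, ?_⟩⟩
  · filter_upwards [h 1 one_pos] with δ hδ z _ hz
    exact hδ z hz
  · filter_upwards [h (ε / 2) (half_pos hε)] with δ hδ z z' _ _ hz hz' _
    calc ‖F Λ δ z - F Λ δ z'‖ ≤ ‖F Λ δ z‖ + ‖F Λ δ z'‖ := norm_sub_le _ _
      _ ≤ ε / 2 * δ ^ ((1:ℝ) / 3) + ε / 2 * δ ^ ((1:ℝ) / 3) := add_le_add (hδ z hz) (hδ z' hz')
      _ = ε * δ ^ ((1:ℝ) / 3) := by ring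

/-- **In the loose-vanishing world the edge-guarded twin IS Smirnov's conjecture, too.** If
`δ^{-1/3}F_δ → 0` uniformly on compacts along every LOOSE family (carrier `D`, mesh `δ`, eventually
admissible — the twin's family class), then both hypotheses of
`CardyComplexCone.ParafermionToSLESixFamilies` hold, so the twin is equivalent to
`SLE6LimitZ2AllDiscretisations`. The edge guards repair the collapse of stmt-11293 but no hypothesis
of the repaired implication excludes the degenerate normalisation; a proof must derive or assume a
`δ^{1/3}` lower bound. [folklore] -/
theorem parafermionToSLESixFamilies_iff_conjecture_of_looseVanishing
    (hV : ∀ (D : DobrushinDomain) (Λ : ℝ → DiscreteDobrushin), (∀ δ, (Λ δ).Ω = D.carrier) →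
      (∀ δ, (Λ δ).δ = δ) → (∀ᶠ δ in 𝓝[>] (0:ℝ), (Λ δ).IsZdAdmissible) →
      ∀ K : Set ℂ, IsCompact K → K ⊆ D.carrier → VanishesOn Λ K) :
    Summit.CriticalPhenomena.CardyFormulaZ2.Theses.CardyComplexCone.ParafermionToSLESixFamilies ↔
      Summit.CriticalPhenomena.CardyFormulaZ2.SLE6LimitZ2AllDiscretisations := by
  rw [← conclusion_iff_sle6LimitZ2AllDiscretisations]
  have hW : ∀ (D : DobrushinDomain) (Λ : ℝ → DiscreteDobrushin), (∀ δ, (Λ δ).Ω = D.carrier) →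
      (∀ δ, (Λ δ).δ = δ) → (∀ᶠ δ in 𝓝[>] (0:ℝ), (Λ δ).IsZdAdmissible) →
      ∀ (φ : ℂ → ℂ), ContDiff ℝ (⊤ : ℕ∞) φ → HasCompactSupport φ → tsupport φ ⊆ D.carrier →
        Tendsto (fun δ : ℝ => ((δ ^ ((5:ℝ) / 3) : ℝ) : ℂ) * ∑ᶠ z : MedialVertex,
          (∫ ω, MedialPath.passageSum (medialExploration (Λ δ) ω) δ (1 / 3) z
            ∂(bondPercolation (zdGraph 2) half)) *
          ((fderiv ℝ φ (medialPoint δ z) 1 + Complex.I * fderiv ℝ φ (medialPoint δ z) Complex.I) / 2))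
          (𝓝[>] (0:ℝ)) (𝓝 0) :=
    fun D Λ h1 h2 h6 φ hφ hsupp hsub =>
      weakSum_tendsto_zero_of_vanishesOn hφ hsupp (hV D Λ h1 h2 h6 _ hsupp.isCompact hsub)
  have hP : ∀ (D : DobrushinDomain) (Λ : ℝ → DiscreteDobrushin), (∀ δ, (Λ δ).Ω = D.carrier) →
      (∀ δ, (Λ δ).δ = δ) → (∀ᶠ δ in 𝓝[>] (0:ℝ), (Λ δ).IsZdAdmissible) →
      ∀ K : Set ℂ, IsCompact K → K ⊆ D.carrier → ClauseBoundEdges Λ K ∧ ClauseEquicontEdges Λ K :=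
    fun D Λ h1 h2 h6 K hK hKD => clausesEdges_of_vanishesOn (hV D Λ h1 h2 h6 K hK hKD)
  -- the crux body spells `Literature.Probability.LatticeModels.passageSum` while `hW`/`hP` (vertex-observable
  -- vocabulary: `ParafermionPrecompact.Negative.F`, `ClauseBoundEdges`, `ClauseEquicontEdges`) spell the
  -- `MedialPath.passageSum` alias — the same function (`MedialPath.passageSum_eq_passageSum'`); `simpa` keeps this
  -- robust whether or not the two names denote distinct constants (Literature alias dedupe pending).
  refine ⟨fun h => h ?_ ?_, fun h _ _ => h⟩
  · simpa only [Literature.Probability.LatticeModels.MedialPath.passageSum_eq_passageSum'] using hW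
  · simpa only [Summit.CriticalPhenomena.CardyFormulaZ2.Theorems.ParafermionPrecompact.Negative.ClauseBoundEdges,
      Summit.CriticalPhenomena.CardyFormulaZ2.Theorems.ParafermionPrecompact.Negative.ClauseEquicontEdges,
      Summit.CriticalPhenomena.CardyFormulaZ2.Theorems.ParafermionPrecompact.Negative.F,
      Literature.Probability.LatticeModels.MedialPath.passageSum_eq_passageSum'] using hP

/-- Negative packaging for the twin: in the loose-vanishing world a failure of the conjecture (and
nothing else) refutes it. [folklore] -/
theorem parafermionToSLESixFamilies_false_of_looseVanishing_of_not_conjecture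
    (hV : ∀ (D : DobrushinDomain) (Λ : ℝ → DiscreteDobrushin), (∀ δ, (Λ δ).Ω = D.carrier) →
      (∀ δ, (Λ δ).δ = δ) → (∀ᶠ δ in 𝓝[>] (0:ℝ), (Λ δ).IsZdAdmissible) →
      ∀ K : Set ℂ, IsCompact K → K ⊆ D.carrier → VanishesOn Λ K)
    (hC : ¬ Summit.CriticalPhenomena.CardyFormulaZ2.SLE6LimitZ2AllDiscretisations) :
    ¬ Summit.CriticalPhenomena.CardyFormulaZ2.Theses.CardyComplexCone.ParafermionToSLESixFamilies :=
  fun h => hC ((parafermionToSLESixFamilies_iff_conjecture_of_looseVanishing hV).1 h)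

/-- In the loose-vanishing world the typed crux and its repaired twin coincide (both are the
conjecture): re-pointing stmt-10814 at the edge-guarded hypotheses changes nothing there.
[folklore] -/
theorem parafermionFamiliesToSLESix_iff_twin_of_looseVanishing
    (hV : ∀ (D : DobrushinDomain) (Λ : ℝ → DiscreteDobrushin), (∀ δ, (Λ δ).Ω = D.carrier) →
      (∀ δ, (Λ δ).δ = δ) → (∀ᶠ δ in 𝓝[>] (0:ℝ), (Λ δ).IsZdAdmissible) →
      ∀ K : Set ℂ, IsCompact K → K ⊆ D.carrier → VanishesOn Λ K) :
    ParafermionFamiliesToSLESix ↔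
      Summit.CriticalPhenomena.CardyFormulaZ2.Theses.CardyComplexCone.ParafermionToSLESixFamilies := by
  rw [parafermionToSLESixFamilies_iff_conjecture_of_looseVanishing hV,
    parafermionFamiliesToSLESix_iff_conjecture_of_vanishing
      (fun D Λ hΛ => hV D Λ hΛ.1 hΛ.2.1 hΛ.2.2.2.2.2)]

end Summit.CriticalPhenomena.CardyFormulaZ2.Theorems.ParafermionFamiliesToSLESix.Negative
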